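import Mathlib
import Summits.ValiantsHypothesis.ValiantsHypothesis.Theorems.GrenetZeonTwoDimCoefficientsScalingOrderTwo
import Summits.ValiantsHypothesis.ValiantsHypothesis.Theorems.GrenetZeonTwoDimCoefficientsScalingCompanionTwo
import Summits.ValiantsHypothesis.ValiantsHypothesis.Theorems.GrenetZeonTwoDimCoefficientsScalingIndexHdeg

/-!
# Crux `GrenetZeon.TwoDimCoefficients` (stmt-ValiantsHypothesis-8062), stub `stub_dualUnipotent`:
# scaling-closure — the regime `m < 3n` is pinned to the PERFECT-SQUARE IDENTITY

For `m < 3n` the shadow of a unipotent dual representation has at most its order-two companion, so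
✓ `sq_le_four_mul_of_orderTwo` applies: either `n² ≤ 4m < 12n` (impossible for `n ≥ 12`) or the shadow is the perfect
square `c(1 + p/2c)²`.  Hence, for `n ≥ 12`:

* ★ `disc_eq_zero_of_lt_three_mul` — `m < 3n`, `deg D₂ ≤ 2n` ⟹ `p² = 4c·Ψ₂` identically (`p = β⁻¹per_n`, `Ψ₂ = [D₂]_{2n}`);
* ★ `sqTrace_eq_of_lt_three_mul` — equivalently (✓ `homogeneousComponent_coeff_det_two_two_mul`) the square-trace of the
  numerator satisfies `[tr((adj A·B)²)]_{2n} = per_n²/(2β²)` EXACTLY;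
* ★ `disc_eq_zero_of_lt_three_mul_of_index` — the same for index-`n` normal forms (`A = A₀(1 − N)`, `Nⁿ = 0`), where
  `deg D₂ ≤ 2n` is automatic (✓ `hdeg_of_index`).

Together with ✓ `two_mul_le_of_dualUnipotentRepr` (`m ≥ 2n`): a unipotent dual representation of `per_n` (`n ≥ 12`) of size
`m < 3n` with `deg D₂ ≤ 2n` exists only if its numerator satisfies the rigid identity `tr((P^top)²) = ½(tr P^top)²`
(for index-`n` pencils, ✓ `companionTwo_eq_top`: the top trace-product matrix `Y = (−N)^{n−1}A₀⁻¹B₁` has `e₂(Y) = e₁(Y)²/4`,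
i.e. characteristic polynomial `t^{m−2}(t − e₁/2)²` when also `e_k(Y) = 0`, `k ≥ 3`).  Excluding this last case — i.e.
proving `m ≥ 3n` — is exactly lemma L1′ (Mignon–Ressayre for the DOUBLE factor `1 + p/2c` at finite `δ`) of the memo
SEVENTEENTH-HAND.md.

HONEST FRAMING: a rigidity statement in the low regime `m < 3n`; the stub `DualUnipotentBound`, the crux and `VP ≠ VNP`
remain open.

References: T. Mignon, N. Ressayre, Int. Math. Res. Not. 2004:79, Thm. 1.1 (via the tree); folklore.
-/

-- single-conjunct layout `Summits/ValiantsHypothesis/ValiantsHypothesis`: the duplicated namespace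
-- component is mandated by the tree.
set_option linter.dupNamespace false
set_option autoImplicit false

noncomputable section

namespace Summit.ValiantsHypothesis.ValiantsHypothesis.Theorems.GrenetZeonTwoDimCoefficients.ScalingClosure

open MvPolynomial Matrix
open Literature.Computability.AlgebraicComplexity
open Summit.ValiantsHypothesis.ValiantsHypothesis.Cruxes.TwoDimCoefficients.DimTwoCases

section ThreeN

/-- ★ **`m < 3n` forces the perfect-square identity** (`n = k + 12 ≥ 12`): `det A = c ≠ 0`,
`per_n = α·det A + β·tr(adj A·B)`, `A, B` affine `m × m`, `2 ≤ m < 3n`, `deg D₂ ≤ 2n` ⟹ `(β⁻¹per_n)² − 4c·[D₂]_{2n} = 0`.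
[cite: MignonRessayre2004, Thm. 1.1 — via the tree; folklore] -/
theorem disc_eq_zero_of_lt_three_mul {k m : ℕ} (A B : AffMat (k + 9 + 3) m) (hA : IsAffine A) (hB : IsAffine B)
    (α β c : ℂ) (hc : c ≠ 0) (hβ : β ≠ 0) (hdet : A.det = MvPolynomial.C c)
    (hper : perPoly (Fin (k + 9 + 3)) ℂ =
      MvPolynomial.C α * A.det + MvPolynomial.C β * (A.adjugate * B).trace)
    (hm2 : 2 ≤ m) (hm : m < 3 * (k + 9 + 3))
    (hdeg2 : ∀ d, 2 * (k + 9 + 3) < d → homogeneousComponent d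
      ((det ((Polynomial.X : Polynomial (MvPolynomial (Fin (k + 9 + 3) × Fin (k + 9 + 3)) ℂ)) •
        B.map Polynomial.C + A.map Polynomial.C)).coeff 2) = 0) :
    (MvPolynomial.C β⁻¹ * perPoly (Fin (k + 9 + 3)) ℂ) ^ 2 -
      MvPolynomial.C (4 * c) * homogeneousComponent (2 * (k + 9 + 3))
        ((det ((Polynomial.X : Polynomial (MvPolynomial (Fin (k + 9 + 3) × Fin (k + 9 + 3)) ℂ)) •
          B.map Polynomial.C + A.map Polynomial.C)).coeff 2) = 0 := by
  classical
  by_contra hdisc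
  set D : ℕ → MvPolynomial (Fin (k + 9 + 3) × Fin (k + 9 + 3)) ℂ := fun j =>
    (det ((Polynomial.X : Polynomial (MvPolynomial (Fin (k + 9 + 3) × Fin (k + 9 + 3)) ℂ)) •
      B.map Polynomial.C + A.map Polynomial.C)).coeff j with hDdef
  have hdegD : ∀ j, (D j).totalDegree ≤ m := fun j => by
    have h := totalDegree_coeff_det_le A B hA hB j
    rwa [Fintype.card_fin] at h
  have hsq := sq_le_four_mul_of_orderTwo (k := k + 9) A B hA hB α β c hc hβ hdet hper hm2 D (fun j => rfl)
    (fun j hj d hd => by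
      rcases (show j = 2 ∨ 3 ≤ j by omega) with rfl | hj3
      · exact hdeg2 d hd
      · exact homogeneousComponent_eq_zero _ _ (lt_of_le_of_lt (hdegD j) (by nlinarith)))
    (fun j hj _ => homogeneousComponent_eq_zero _ _ (lt_of_le_of_lt (hdegD j) (by nlinarith))) hdisc
  nlinarith

/-- ★ **The same as the square-trace identity**: under the hypotheses of `disc_eq_zero_of_lt_three_mul`,
`[tr((adj A·B)²)]_{2n} = per_n²/(2β²)`. [cite: MignonRessayre2004, Thm. 1.1 — via the tree; folklore] -/
theorem sqTrace_eq_of_lt_three_mul {k m : ℕ} (A B : AffMat (k + 9 + 3) m) (hA : IsAffine A) (hB : IsAffine B)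
    (α β c : ℂ) (hc : c ≠ 0) (hβ : β ≠ 0) (hdet : A.det = MvPolynomial.C c)
    (hper : perPoly (Fin (k + 9 + 3)) ℂ =
      MvPolynomial.C α * A.det + MvPolynomial.C β * (A.adjugate * B).trace)
    (hm2 : 2 ≤ m) (hm : m < 3 * (k + 9 + 3))
    (hdeg2 : ∀ d, 2 * (k + 9 + 3) < d → homogeneousComponent d
      ((det ((Polynomial.X : Polynomial (MvPolynomial (Fin (k + 9 + 3) × Fin (k + 9 + 3)) ℂ)) •
        B.map Polynomial.C + A.map Polynomial.C)).coeff 2) = 0) :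
    homogeneousComponent (2 * (k + 9 + 3)) (((A.adjugate * B) ^ 2).trace) =
      MvPolynomial.C (β⁻¹ ^ 2 / 2) * perPoly (Fin (k + 9 + 3)) ℂ ^ 2 := by
  have h := disc_eq_zero_of_lt_three_mul A B hA hB α β c hc hβ hdet hper hm2 hm hdeg2
  rw [homogeneousComponent_coeff_det_two_two_mul (by omega) A B α β c hc hβ hdet hper] at h
  -- solve the linear equation for the square-trace component
  set W := homogeneousComponent (2 * (k + 9 + 3)) (((A.adjugate * B) ^ 2).trace) with hW
  set Q := perPoly (Fin (k + 9 + 3)) ℂ with hQ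
  have key : (MvPolynomial.C (4 * c) : MvPolynomial (Fin (k + 9 + 3) × Fin (k + 9 + 3)) ℂ) *
      MvPolynomial.C (2 * c)⁻¹ = 2 := by
    rw [← map_mul, show (4 * c) * (2 * c)⁻¹ = (2 : ℂ) by field_simp; ring]
    exact map_ofNat _ 2
  rw [← mul_assoc, key, map_pow] at h
  have h3 : (2 : MvPolynomial (Fin (k + 9 + 3) × Fin (k + 9 + 3)) ℂ) * W = MvPolynomial.C β⁻¹ ^ 2 * Q ^ 2 := by
    linear_combination h
  have h2 : W = MvPolynomial.C (2 : ℂ)⁻¹ * ((2 : MvPolynomial (Fin (k + 9 + 3) × Fin (k + 9 + 3)) ℂ) * W) := by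
    rw [← mul_assoc, ← map_ofNat (MvPolynomial.C) 2, ← map_mul, inv_mul_cancel₀ two_ne_zero, map_one, one_mul]
  rw [h2, h3, ← mul_assoc, ← map_pow, ← map_mul]
  congr 2
  rw [div_eq_mul_inv, mul_comm]

/-- ★ **Index-`n` version**: for a normal form `A = A₀(1 − N)`, `Nⁿ = 0` (so `deg D₂ ≤ 2n` automatically), `n ≥ 12`,
`2 ≤ m < 3n` ⟹ `(β⁻¹per_n)² = 4c·[D₂]_{2n}`. [cite: MignonRessayre2004, Thm. 1.1 — via the tree; folklore] -/
theorem disc_eq_zero_of_lt_three_mul_of_index {k m : ℕ} (A B : AffMat (k + 9 + 3) m) (hA : IsAffine A)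
    (hB : IsAffine B) (α β c : ℂ) (hc : c ≠ 0) (hβ : β ≠ 0) (hdet : A.det = MvPolynomial.C c)
    (hper : perPoly (Fin (k + 9 + 3)) ℂ =
      MvPolynomial.C α * A.det + MvPolynomial.C β * (A.adjugate * B).trace)
    (hm2 : 2 ≤ m) (hm : m < 3 * (k + 9 + 3))
    (A₀ P₀ : Matrix (Fin m) (Fin m) ℂ) (hP₀ : A₀ * P₀ = 1) (N : AffMat (k + 9 + 3) m)
    (hN : ∀ i j, (N i j).IsHomogeneous 1) (hNn : N ^ (k + 9 + 3) = 0)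
    (hAN : A = A₀.map MvPolynomial.C * (1 - N)) :
    (MvPolynomial.C β⁻¹ * perPoly (Fin (k + 9 + 3)) ℂ) ^ 2 -
      MvPolynomial.C (4 * c) * homogeneousComponent (2 * (k + 9 + 3))
        ((det ((Polynomial.X : Polynomial (MvPolynomial (Fin (k + 9 + 3) × Fin (k + 9 + 3)) ℂ)) •
          B.map Polynomial.C + A.map Polynomial.C)).coeff 2) = 0 :=
  disc_eq_zero_of_lt_three_mul A B hA hB α β c hc hβ hdet hper hm2 hm (fun d hd =>
    hdeg_of_index (by omega) A₀ P₀ hP₀ N hN hNn A B hAN hB c hc hdet (fun j =>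
      (det ((Polynomial.X : Polynomial (MvPolynomial (Fin (k + 9 + 3) × Fin (k + 9 + 3)) ℂ)) •
        B.map Polynomial.C + A.map Polynomial.C)).coeff j) (fun _ => rfl) 2 le_rfl d hd)

end ThreeN

end Summit.ValiantsHypothesis.ValiantsHypothesis.Theorems.GrenetZeonTwoDimCoefficients.ScalingClosure

end
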